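/- Width seat 3/3 `ym-line-cbag-p1-w3` (prover-ym-line-cbag-p1-w3-g14-0) of the cell of ideator ym-idea-2, LINE 8
(route `EguchiKawaiDirectionLadder`): the CEILING of the centre-symmetric small-ball exponent is `(d − 1)/2`, so the
free-energy mechanism behind `EguchiKawaiBreakdown` has an empty window in `d = 2`.  Route-independent (no `Theses`
import); YM mass gap NOT touched (barrier-ledger line). -/
import Literature.Barriers.QuantumFields.EguchiKawaiBreakdownLowerBound
import HarnessLib

/-!
# The centre-symmetric small-ball exponent is at most `(d − 1)/2`: the breakdown window `d/4 < e ≤ (d−1)/2` is empty iff `d ≤ 2`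

`EguchiKawaiBreakdown` is proved in the tree from ONE family of estimates, `EKSymSmallBallBound d δ e C`
(`Haar^{⊗d}(Sym_δ ∩ {S_R ≤ t}) ≤ exp(N²(e log t + C))`) with an exponent `e > d/4` (`EguchiKawaiBreakdown_of_smallBall`;
this cell supplied `e = 4/5` at `d = 3` and the increment `(1 − 2δ)/4` per direction); the tree's "other bracket" is
`e ≤ d/2` (`not_ekSymSmallBallBound_of_half_lt`: all `d` links near ONE traceless commuting unitary).  This file SHARPENS it to
`EKSymSmallBallBound d δ e C → e ≤ (d − 1)/2` (`exponent_le_half_pred`) with a cheaper centre-symmetric almost-commuting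
family: the FIRST link is free (any `U₀` with `|(1/N) tr U₀|² ≤ δ/4` — Haar probability `≥ 1/2` once `N² ≥ 8/δ`, by
`E_Haar|tr U|² = 1` and Chebyshev), the other `d − 1` links lie in the operator-norm ball of radius `ε` around `U₀`
(`S_R ≤ 4d²ε²` by the tree's `ekAction_le_of_near_const` with `D := U₀`; `|(1/N) tr U_μ| ≤ |(1/N) tr U₀| + ε`; measure
`≥ ½ (ε/(2π+ε))^{(d−1)N²}` by a measure-preserving shear, left invariance and `haar_unitaryOpBall_ge`).  Consequences:
`not_ekSymSmallBallBound_two_of_half_lt` / `not_exists_margin_two` / `not_exists_margin_of_le_two` — for `d ≤ 2` the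
hypothesis of `EguchiKawaiBreakdown_of_smallBall` has NO instance: the free-energy (collapsed-vacuum vs. centre-symmetric
Laplace exponent) mechanism of the barrier cannot operate in two dimensions — the formal counterpart of "(14.77): for
`d = 2` the exponent vanishes … the naive reduction is valid in `d = 2`" (Makeenko §14.4–14.5; evasion (e) of the barrier
entry); `margin_window_nonempty_iff` — the window `d/4 < (d − 1)/2` is non-empty iff `3 ≤ d`, the dimension threshold of
`EguchiKawaiBreakdown` (and for `d ≥ 3` it IS inhabited: this cell's `ekSymSmallBallBound_explicit`, `e = d/4 + (d+3)/(40d)`).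

HONEST FRAMING.  Nothing here says the `d = 2` Eguchi–Kawai model IS centre symmetric at weak coupling (a large-`N` theorem
about the two-matrix model, not claimed); it says the tree's route to breakdown provably does not extend to `d ≤ 2`.  No
summit statement, no mass gap, no continuum or reduction claim is proved or advanced here (barrier-ledger line).
-/

set_option autoImplicit false

noncomputable section

open MeasureTheory Filter Topology Real
open scoped Matrix Matrix.Norms.L2Operator ENNReal
open Literature.Barriers.QuantumFields

namespace Summit.QuantumFields.YangMills.Theorems.EguchiKawaiDirectionLadder

/-! ## Chebyshev for the open line under Haar -/

/-- `E_Haar |(1/N) tr U|² = 1/N²` on `U(N)`, `N ≥ 1` (from the tree's `E_Haar |tr U|² = 1`). -/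
theorem integral_normSq_trace_div (N : ℕ) (hN : 0 < N) :
    ∫ V, ‖Matrix.trace (V : Matrix (Fin N) (Fin N) ℂ) / (N : ℂ)‖ ^ 2 ∂haarUN N = 1 / (N : ℝ) ^ 2 := by
  have h : ∀ V : UN N, ‖Matrix.trace (V : Matrix (Fin N) (Fin N) ℂ) / (N : ℂ)‖ ^ 2 =
      (1 / (N : ℝ) ^ 2) * ‖Matrix.trace (V : Matrix (Fin N) (Fin N) ℂ)‖ ^ 2 := by
    intro V
    rw [norm_div, Complex.norm_natCast, div_pow]
    ring
  simp_rw [h]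
  rw [integral_const_mul, integral_norm_sq_trace hN, mul_one]

/-- **Most unitaries have a small open line**: for `N ≥ 1` with `N² ≥ 2/s`, the Haar probability of
`{|(1/N) tr V|² ≤ s}` is at least `1/2` (Chebyshev with `E_Haar |(1/N) tr V|² = 1/N²`). -/
theorem haar_normSq_trace_le_ge_half (N : ℕ) (hN : 0 < N) {s : ℝ} (hs : 0 < s) (hNs : 2 / s ≤ (N : ℝ) ^ 2) :
    ENNReal.ofReal (1 / 2) ≤
      haarUN N {V | ‖Matrix.trace (V : Matrix (Fin N) (Fin N) ℂ) / (N : ℂ)‖ ^ 2 ≤ s} := by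
  set f : UN N → ℝ := fun V => ‖Matrix.trace (V : Matrix (Fin N) (Fin N) ℂ) / (N : ℂ)‖ ^ 2 with hf
  have hfc : Continuous f :=
    (((Continuous.matrix_trace continuous_subtype_val).div_const _).norm).pow 2
  have hfi : Integrable f (haarUN N) := integrable_of_continuous hfc
  have hnn : 0 ≤ᵐ[haarUN N] f := Eventually.of_forall fun V => by positivity
  have hcheb := mul_meas_ge_le_integral_of_nonneg hnn hfi s
  rw [hf, integral_normSq_trace_div N hN] at hcheb
  have hN2 : (0 : ℝ) < (N : ℝ) ^ 2 := by positivity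
  have hbad : (haarUN N).real {V | s ≤ f V} ≤ 1 / 2 := by
    have h1 : (haarUN N).real {V | s ≤ f V} ≤ 1 / (N : ℝ) ^ 2 / s := by
      rw [le_div_iff₀ hs, mul_comm]; exact hcheb
    refine h1.trans ?_
    rw [div_div, div_le_iff₀ (by positivity)]
    have : 2 ≤ s * (N : ℝ) ^ 2 := by rwa [div_le_iff₀ hs, mul_comm] at hNs
    linarith
  have hcompl : {V | f V ≤ s}ᶜ ⊆ {V | s ≤ f V} := by
    intro V hV
    simp only [Set.mem_compl_iff, Set.mem_setOf_eq, not_le] at hV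
    exact hV.le
  have hmeas : MeasurableSet {V | f V ≤ s} := (isClosed_le hfc continuous_const).measurableSet
  have hreal : 1 / 2 ≤ (haarUN N).real {V | f V ≤ s} := by
    have htot : (haarUN N).real {V | f V ≤ s} + (haarUN N).real {V | f V ≤ s}ᶜ = 1 := by
      rw [measureReal_add_measureReal_compl hmeas, probReal_univ]
    have hc : (haarUN N).real {V | f V ≤ s}ᶜ ≤ 1 / 2 :=
      (measureReal_mono hcompl).trans hbad
    linarith
  calc ENNReal.ofReal (1 / 2) ≤ ENNReal.ofReal ((haarUN N).real {V | f V ≤ s}) := ENNReal.ofReal_le_ofReal hreal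
    _ = haarUN N {V | f V ≤ s} := ofReal_measureReal (measure_ne_top _ _)

/-! ## The centre-symmetric almost-commuting family around a free first link -/

/-- The product measure `∏_μ dU_μ` on `U(N)^d` is left invariant (pointwise group structure). -/
theorem ekHaar_isMulLeftInvariant (d N : ℕ) : (ekHaar d N).IsMulLeftInvariant := by
  unfold ekHaar; exact Measure.pi.isMulLeftInvariant _

/-- **The shear `(V, W) ↦ (V, (V⁻¹ W_μ)_μ)` preserves `dV ⊗ ∏_μ dW_μ`** (left invariance of the product Haar measure,
fibrewise; Mathlib's `MeasurePreserving.skew_product`). -/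
theorem measurePreserving_shear (d N : ℕ) :
    MeasurePreserving (fun p : UN N × EKConfig d N => (p.1, fun μ => p.1⁻¹ * p.2 μ))
      ((haarUN N).prod (ekHaar d N)) ((haarUN N).prod (ekHaar d N)) := by
  haveI := ekHaar_isMulLeftInvariant d N
  have hg : Measurable (Function.uncurry fun (V : UN N) (W : EKConfig d N) => fun μ => V⁻¹ * W μ) := by
    refine measurable_pi_lambda _ fun μ => ?_
    exact (measurable_fst.inv).mul ((measurable_pi_apply μ).comp measurable_snd)
  refine (MeasurePreserving.id (haarUN N)).skew_product hg (Eventually.of_forall fun V => ?_)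
  have : (fun W : EKConfig d N => fun μ => V⁻¹ * W μ) = fun W => (fun _ : Fin d => V⁻¹) * W := by
    funext W; rfl
  rw [this]
  exact map_mul_left_eq_self _ _

/-- **The centre-symmetric small-ball exponent is at most `(d − 1)/2`** (stated at `d + 1` links, ceiling `d/2`):
for every `δ > 0`, `e > d/2`, `C`, `EKSymSmallBallBound (d + 1) δ e C` FAILS.  Witnesses: a free first link `U₀` with
`|(1/N) tr U₀|² ≤ δ/4` and `d` links in the operator-norm ball of radius `ε = e^{−T} ≤ √δ/2` around `U₀` (open lines `≤ √δ`,
`S_R ≤ 4(d+1)²ε²`, measure `≥ ½ (ε/(2π+ε))^{dN²}`) — incompatible with `exp(N²(e log(4(d+1)²ε²) + C))` for `2e > d`, `T` large. -/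
theorem not_ekSymSmallBallBound_succ_of_half_lt (d : ℕ) {δ e C : ℝ} (hδ : 0 < δ) (he : (d : ℝ) / 2 < e) :
    ¬ EKSymSmallBallBound (d + 1) δ e C := by
  rintro ⟨N₀, h⟩
  obtain ⟨N, hN₀N, hceil⟩ : ∃ N : ℕ, N₀ ≤ N ∧ ⌈8 / δ⌉₊ + 1 ≤ N :=
    ⟨max N₀ (⌈8 / δ⌉₊ + 1), le_max_left _ _, le_max_right _ _⟩
  have hNpos : 0 < N := by omega
  have hN1 : (1 : ℝ) ≤ N := by exact_mod_cast hNpos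
  have hNδ : 8 / δ ≤ (N : ℝ) ^ 2 := by
    have h1 : 8 / δ ≤ (⌈8 / δ⌉₊ : ℝ) := Nat.le_ceil _
    have h2 : (⌈8 / δ⌉₊ : ℝ) + 1 ≤ N := by exact_mod_cast hceil
    have h4 : (N : ℝ) ≤ (N : ℝ) ^ 2 := by rw [sq]; exact le_mul_of_one_le_left (by linarith) hN1
    linarith
  have hNr : (0 : ℝ) < N := by exact_mod_cast hNpos
  have hd' : (0 : ℝ) ≤ d := by positivity
  have h2ed : 0 < 2 * e - d := by linarith
  have hepos : 0 < e := by linarith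
  have hlog2 : 0 < Real.log 2 := Real.log_pos (by norm_num)
  -- constants: K = log(4(d+1)²), L₁ = log(2π+1), M, R, and the scale T
  have hKpos : 0 < Real.log (4 * ((d : ℝ) + 1) ^ 2) := by
    refine Real.log_pos ?_; nlinarith
  have hL1pos : 0 < Real.log (2 * π + 1) := Real.log_pos (by linarith [Real.pi_pos])
  obtain ⟨M, hM⟩ : ∃ M : ℝ, M = e * Real.log (4 * ((d : ℝ) + 1) ^ 2) + C + d * Real.log (2 * π + 1) + Real.log 2 :=
    ⟨_, rfl⟩
  obtain ⟨T, hTdef⟩ : ∃ T : ℝ, T = |M / (2 * e - d)| + 1 + |Real.log δ| / 2 + Real.log 2 := ⟨_, rfl⟩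
  have hT0 : 0 < T := by rw [hTdef]; positivity
  have hTR : M / (2 * e - d) < T := by
    rw [hTdef]; have := le_abs_self (M / (2 * e - d)); have := abs_nonneg (Real.log δ); linarith
  obtain ⟨ε, hε⟩ : ∃ ε : ℝ, ε = Real.exp (-T) := ⟨_, rfl⟩
  have hεpos : 0 < ε := by rw [hε]; exact Real.exp_pos _
  have hε1 : ε ≤ 1 := by rw [hε, Real.exp_le_one_iff]; linarith
  have hlogε : Real.log ε = -T := by rw [hε, Real.log_exp]
  -- ε ≤ √δ / 2, in the form ε² ≤ δ/4
  have hε2δ : ε ^ 2 ≤ δ / 4 := by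
    have h1 : ε ^ 2 = Real.exp (-(2 * T)) := by
      rw [hε, ← Real.exp_nat_mul]; congr 1; push_cast; ring
    have h2 : Real.exp (-(2 * T)) ≤ Real.exp (-|Real.log δ| - 2 * Real.log 2) := by
      rw [Real.exp_le_exp, hTdef]; have := abs_nonneg (M / (2 * e - d)); linarith
    have h3 : Real.exp (-|Real.log δ| - 2 * Real.log 2) ≤ δ / 4 := by
      have h4 : Real.exp (-|Real.log δ|) ≤ δ := by
        rcases le_or_gt (Real.log δ) 0 with hl | hl
        · rw [abs_of_nonpos hl, neg_neg, Real.exp_log hδ]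
        · rw [abs_of_pos hl]
          have : Real.exp (-Real.log δ) ≤ Real.exp (Real.log δ) := Real.exp_le_exp.2 (by linarith)
          rwa [Real.exp_log hδ] at this
      have h5 : Real.exp (-(2 * Real.log 2)) = 1 / 4 := by
        rw [show (2 : ℝ) * Real.log 2 = Real.log 4 by
          rw [show (4 : ℝ) = 2 ^ 2 by norm_num, Real.log_pow]; norm_num,
          Real.exp_neg, Real.exp_log (by norm_num), one_div]
      rw [show -|Real.log δ| - 2 * Real.log 2 = -|Real.log δ| + -(2 * Real.log 2) by ring, Real.exp_add, h5]
      linarith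
    rw [h1]; exact h2.trans h3
  obtain ⟨t, ht⟩ : ∃ t : ℝ, t = 4 * ((d : ℝ) + 1) ^ 2 * ε ^ 2 := ⟨_, rfl⟩
  have htpos : 0 < t := by rw [ht]; positivity
  have hlogt : Real.log t = Real.log (4 * ((d : ℝ) + 1) ^ 2) - 2 * T := by
    rw [ht, Real.log_mul (by positivity) (by positivity), Real.log_pow, hlogε]; ring
  haveI : Nonempty (Fin N) := ⟨⟨0, hNpos⟩⟩
  let A : Set (UN N) := {V | ‖Matrix.trace (V : Matrix (Fin N) (Fin N) ℂ) / (N : ℂ)‖ ^ 2 ≤ δ / 4}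
  let S' : Set (UN N × EKConfig d N) :=
    {p | p.1 ∈ A ∧ ∀ μ : Fin d, ‖(p.2 μ : Matrix (Fin N) (Fin N) ℂ) - (p.1 : Matrix (Fin N) (Fin N) ℂ)‖ ≤ ε}
  let E : Set (EKConfig (d + 1) N) := ekSymRegion (d + 1) N δ ∩ {U | ekAction U ≤ t}
  let Box : Set (UN N × EKConfig d N) := A ×ˢ Set.pi Set.univ (fun _ : Fin d => unitaryOpBall N ε)
  let shear : UN N × EKConfig d N → UN N × EKConfig d N := fun p => (p.1, fun μ => p.1⁻¹ * p.2 μ)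
  have hBoxS' : shear ⁻¹' Box ⊆ S' := by
    rintro ⟨V, W⟩ hp
    have hp' : V ∈ A ∧ ∀ μ : Fin d, V⁻¹ * W μ ∈ unitaryOpBall N ε := by
      simpa [shear, Box, Set.mem_preimage, Set.mem_prod, Set.mem_pi, Set.mem_univ] using hp
    obtain ⟨hV, hW⟩ := hp'
    refine ⟨hV, fun μ => ?_⟩
    have hWμ : ‖((V⁻¹ * W μ : UN N) : Matrix (Fin N) (Fin N) ℂ) - 1‖ ≤ ε := hW μ
    have hVV : (V : Matrix (Fin N) (Fin N) ℂ) * star (V : Matrix (Fin N) (Fin N) ℂ) = 1 :=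
      Unitary.coe_mul_star_self V
    have hfac : (W μ : Matrix (Fin N) (Fin N) ℂ) - (V : Matrix (Fin N) (Fin N) ℂ) =
        (V : Matrix (Fin N) (Fin N) ℂ) * (((V⁻¹ * W μ : UN N) : Matrix (Fin N) (Fin N) ℂ) - 1) := by
      show _ = (V : Matrix (Fin N) (Fin N) ℂ) * (star (V : Matrix (Fin N) (Fin N) ℂ) * (W μ : Matrix (Fin N) (Fin N) ℂ) - 1)
      rw [mul_sub, ← mul_assoc, hVV, one_mul, mul_one]
    have hVn : ‖(V : Matrix (Fin N) (Fin N) ℂ)‖ = 1 := CStarRing.norm_coe_unitary V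
    show ‖(W μ : Matrix (Fin N) (Fin N) ℂ) - (V : Matrix (Fin N) (Fin N) ℂ)‖ ≤ ε
    rw [hfac]
    calc _ ≤ ‖(V : Matrix (Fin N) (Fin N) ℂ)‖ * ‖((V⁻¹ * W μ : UN N) : Matrix (Fin N) (Fin N) ℂ) - 1‖ :=
          norm_mul_le _ _
      _ ≤ 1 * ε := by rw [hVn]; gcongr
      _ = ε := one_mul ε
  let eqv := MeasurableEquiv.piFinSuccAbove (fun _ : Fin (d + 1) => UN N) 0
  have hmp : MeasurePreserving eqv (ekHaar (d + 1) N) ((haarUN N).prod (ekHaar d N)) := by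
    unfold ekHaar
    exact measurePreserving_piFinSuccAbove (fun _ : Fin (d + 1) => haarUN N) 0
  have hS'E : eqv ⁻¹' S' ⊆ E := by
    intro U hU
    have hU2 : ∀ μ : Fin d, (eqv U).2 μ = U (Fin.succ μ) := fun μ => by
      show U ((0 : Fin (d + 1)).succAbove μ) = U μ.succ
      rw [Fin.succAbove_zero]
    have hV : ‖Matrix.trace ((U 0 : UN N) : Matrix (Fin N) (Fin N) ℂ) / (N : ℂ)‖ ^ 2 ≤ δ / 4 := hU.1
    have hW : ∀ μ : Fin d,
        ‖(U μ.succ : Matrix (Fin N) (Fin N) ℂ) - ((U 0 : UN N) : Matrix (Fin N) (Fin N) ℂ)‖ ≤ ε := by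
      intro μ
      have := hU.2 μ
      rwa [hU2 μ] at this
    have hnear : ∀ ν : Fin (d + 1),
        ‖(U ν : Matrix (Fin N) (Fin N) ℂ) - ((U 0 : UN N) : Matrix (Fin N) (Fin N) ℂ)‖ ≤ ε := by
      intro ν
      refine Fin.cases ?_ (fun μ => hW μ) ν
      simp only [sub_self, norm_zero]
      exact hεpos.le
    refine ⟨fun ν => ?_, ?_⟩
    · -- open lines: |tr U_ν/N| ≤ |tr U_0/N| + ε ≤ √δ/2 + √δ/2
      have h1 := norm_openLine_le_of_near hNpos (U 0) U ν
      have ha0 := norm_nonneg (Matrix.trace ((U 0 : UN N) : Matrix (Fin N) (Fin N) ℂ) / (N : ℂ))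
      have h2 : ‖openLine ν U‖ ≤ ‖Matrix.trace ((U 0 : UN N) : Matrix (Fin N) (Fin N) ℂ) / (N : ℂ)‖ + ε :=
        h1.trans (add_le_add le_rfl (hnear ν))
      have h2aε : 2 * ‖Matrix.trace ((U 0 : UN N) : Matrix (Fin N) (Fin N) ℂ) / (N : ℂ)‖ * ε ≤
          ‖Matrix.trace ((U 0 : UN N) : Matrix (Fin N) (Fin N) ℂ) / (N : ℂ)‖ ^ 2 + ε ^ 2 := by
        nlinarith [sq_nonneg (‖Matrix.trace ((U 0 : UN N) : Matrix (Fin N) (Fin N) ℂ) / (N : ℂ)‖ - ε)]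
      have hsq : (‖Matrix.trace ((U 0 : UN N) : Matrix (Fin N) (Fin N) ℂ) / (N : ℂ)‖ + ε) ^ 2 ≤ δ := by
        calc (‖Matrix.trace ((U 0 : UN N) : Matrix (Fin N) (Fin N) ℂ) / (N : ℂ)‖ + ε) ^ 2
            = ‖Matrix.trace ((U 0 : UN N) : Matrix (Fin N) (Fin N) ℂ) / (N : ℂ)‖ ^ 2 +
                2 * ‖Matrix.trace ((U 0 : UN N) : Matrix (Fin N) (Fin N) ℂ) / (N : ℂ)‖ * ε + ε ^ 2 := by ring
          _ ≤ 2 * ‖Matrix.trace ((U 0 : UN N) : Matrix (Fin N) (Fin N) ℂ) / (N : ℂ)‖ ^ 2 + 2 * ε ^ 2 := by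
                linarith
          _ ≤ δ := by linarith
      calc ‖openLine ν U‖ ^ 2 ≤ (‖Matrix.trace ((U 0 : UN N) : Matrix (Fin N) (Fin N) ℂ) / (N : ℂ)‖ + ε) ^ 2 :=
            pow_le_pow_left₀ (norm_nonneg _) h2 2
        _ ≤ δ := hsq
    · show ekAction U ≤ t
      rw [ht]
      have := ekAction_le_of_near_const hNpos (U 0) U hnear
      push_cast at this
      exact this
  have hvolBox : ENNReal.ofReal (1 / 2) * ENNReal.ofReal (((ε / (2 * π + ε)) ^ (N * N)) ^ d) ≤
      ((haarUN N).prod (ekHaar d N)) Box := by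
    rw [Measure.prod_prod]
    refine mul_le_mul' ?_ ?_
    · refine haar_normSq_trace_le_ge_half N hNpos (by positivity) ?_
      have : 2 / (δ / 4) = 8 / δ := by field_simp; ring
      rw [this]; exact hNδ
    · unfold ekHaar
      rw [Measure.pi_pi,
        show (((ε / (2 * π + ε)) ^ (N * N)) ^ d) = ∏ _μ : Fin d, (ε / (2 * π + ε)) ^ (N * N) by simp,
        ENNReal.ofReal_prod_of_nonneg (fun _ _ => by positivity)]
      exact Finset.prod_le_prod' fun μ _ => haar_unitaryOpBall_ge _ hεpos
  have hshear : MeasurePreserving shear ((haarUN N).prod (ekHaar d N)) ((haarUN N).prod (ekHaar d N)) :=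
    measurePreserving_shear d N
  have hcontA : Continuous fun V : UN N => ‖Matrix.trace (V : Matrix (Fin N) (Fin N) ℂ) / (N : ℂ)‖ ^ 2 :=
    (((Continuous.matrix_trace continuous_subtype_val).div_const _).norm).pow 2
  have hAmeas : MeasurableSet A := (isClosed_le hcontA continuous_const).measurableSet
  have hBoxmeas : MeasurableSet Box :=
    hAmeas.prod (MeasurableSet.univ_pi fun _ => measurableSet_unitaryOpBall ε)
  have hS'closed : IsClosed S' := by
    have hS'eq : S' = (Prod.fst ⁻¹' A) ∩ ⋂ μ : Fin d,
        {p : UN N × EKConfig d N | ‖(p.2 μ : Matrix (Fin N) (Fin N) ℂ) - (p.1 : Matrix (Fin N) (Fin N) ℂ)‖ ≤ ε} := by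
      ext p
      simp only [S', Set.mem_setOf_eq, Set.mem_inter_iff, Set.mem_preimage, Set.mem_iInter]
    rw [hS'eq]
    refine ((isClosed_le hcontA continuous_const).preimage continuous_fst).inter (isClosed_iInter fun μ => ?_)
    refine isClosed_le ?_ continuous_const
    refine Continuous.norm ?_
    exact (continuous_subtype_val.comp ((continuous_apply μ).comp continuous_snd)).sub
      (continuous_subtype_val.comp continuous_fst)
  have hBox_le_S' : ((haarUN N).prod (ekHaar d N)) Box ≤ ((haarUN N).prod (ekHaar d N)) S' := by
    calc ((haarUN N).prod (ekHaar d N)) Box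
        = ((haarUN N).prod (ekHaar d N)) (shear ⁻¹' Box) :=
          (hshear.measure_preimage hBoxmeas.nullMeasurableSet).symm
      _ ≤ ((haarUN N).prod (ekHaar d N)) S' := measure_mono hBoxS'
  have hS'_le_E : ((haarUN N).prod (ekHaar d N)) S' ≤ ekHaar (d + 1) N E := by
    calc ((haarUN N).prod (ekHaar d N)) S' = ekHaar (d + 1) N (eqv ⁻¹' S') :=
          (hmp.measure_preimage hS'closed.measurableSet.nullMeasurableSet).symm
      _ ≤ ekHaar (d + 1) N E := measure_mono hS'E
  have hchain := ((hvolBox.trans hBox_le_S').trans hS'_le_E).trans (h N hN₀N t htpos)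
  rw [← ENNReal.ofReal_mul (by norm_num), ENNReal.ofReal_le_ofReal_iff (Real.exp_pos _).le] at hchain
  have hq : Real.exp (-(T + Real.log (2 * π + 1))) ≤ ε / (2 * π + ε) := by
    have h1 : Real.exp (-(T + Real.log (2 * π + 1))) = ε / (2 * π + 1) := by
      rw [neg_add, Real.exp_add, ← hε, Real.exp_neg, Real.exp_log (by linarith [Real.pi_pos])]
      ring
    rw [h1]
    exact div_le_div_of_nonneg_left hεpos.le (by linarith [Real.pi_pos]) (by linarith)
  have hlow : Real.exp (-Real.log 2 - ((N * N * d : ℕ) : ℝ) * (T + Real.log (2 * π + 1))) ≤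
      1 / 2 * ((ε / (2 * π + ε)) ^ (N * N)) ^ d := by
    rw [show -Real.log 2 - ((N * N * d : ℕ) : ℝ) * (T + Real.log (2 * π + 1)) =
        -Real.log 2 + ((N * N * d : ℕ) : ℝ) * (-(T + Real.log (2 * π + 1))) by ring,
      Real.exp_add, Real.exp_nat_mul, Real.exp_neg, Real.exp_log (by norm_num), ← pow_mul, ← one_div]
    refine mul_le_mul_of_nonneg_left ?_ (by norm_num)
    exact pow_le_pow_left₀ (Real.exp_pos _).le hq _
  have hexp := hlow.trans hchain
  rw [Real.exp_le_exp, hlogt] at hexp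
  push_cast at hexp
  -- hexp : -log 2 - N*N*d*(T + L₁) ≤ N²(e (K − 2T) + C); conclude T ≤ M/(2e − d) < T
  have hX1 : (1 : ℝ) ≤ (N : ℝ) ^ 2 := by nlinarith
  have hXpos : (0 : ℝ) < (N : ℝ) ^ 2 := by positivity
  have hlx : Real.log 2 ≤ Real.log 2 * (N : ℝ) ^ 2 := le_mul_of_one_le_right hlog2.le hX1
  have id1 : (N : ℝ) ^ 2 * ((2 * e - d) * T) =
      -((N : ℝ) ^ 2 * (e * (Real.log (4 * ((d : ℝ) + 1) ^ 2) - 2 * T) + C)) +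
        e * Real.log (4 * ((d : ℝ) + 1) ^ 2) * (N : ℝ) ^ 2 + C * (N : ℝ) ^ 2 - (d : ℝ) * (N : ℝ) ^ 2 * T := by
    ring
  have id2 : (N : ℝ) * N * d * (T + Real.log (2 * π + 1)) =
      (d : ℝ) * (N : ℝ) ^ 2 * T + (d : ℝ) * (N : ℝ) ^ 2 * Real.log (2 * π + 1) := by ring
  have id3 : (N : ℝ) ^ 2 * M = e * Real.log (4 * ((d : ℝ) + 1) ^ 2) * (N : ℝ) ^ 2 + C * (N : ℝ) ^ 2 +
      (d : ℝ) * (N : ℝ) ^ 2 * Real.log (2 * π + 1) + Real.log 2 * (N : ℝ) ^ 2 := by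
    rw [hM]; ring
  rw [id2] at hexp
  have key : (N : ℝ) ^ 2 * ((2 * e - d) * T) ≤ (N : ℝ) ^ 2 * M := by
    rw [id1, id3]; linarith
  have key' : (2 * e - d) * T ≤ M := le_of_mul_le_mul_left key hXpos
  have key2 : T ≤ M / (2 * e - d) := by
    rw [le_div_iff₀ h2ed]; linarith
  linarith

/-- **Ceiling `(d − 1)/2`** (the same, indexed by `d ≥ 1`). -/
theorem not_ekSymSmallBallBound_of_half_pred_lt {d : ℕ} (hd : 1 ≤ d) {δ e C : ℝ} (hδ : 0 < δ)
    (he : ((d : ℝ) - 1) / 2 < e) : ¬ EKSymSmallBallBound d δ e C := by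
  obtain ⟨d', rfl⟩ := Nat.exists_eq_add_of_le' hd
  refine not_ekSymSmallBallBound_succ_of_half_lt d' hδ ?_
  push_cast at he
  linarith

/-- **Contrapositive: every valid centre-symmetric small-ball exponent is `≤ (d − 1)/2`** (`d ≥ 1`, `δ > 0`). -/
theorem exponent_le_half_pred {d : ℕ} (hd : 1 ≤ d) {δ e C : ℝ} (hδ : 0 < δ)
    (h : EKSymSmallBallBound d δ e C) : e ≤ ((d : ℝ) - 1) / 2 := by
  by_contra hlt
  exact not_ekSymSmallBallBound_of_half_pred_lt hd hδ (lt_of_not_ge hlt) h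

/-- **`d = 2`: no exponent above `1/2 = d/4`.** -/
theorem not_ekSymSmallBallBound_two_of_half_lt {δ e C : ℝ} (hδ : 0 < δ) (he : (1 : ℝ) / 2 < e) :
    ¬ EKSymSmallBallBound 2 δ e C :=
  not_ekSymSmallBallBound_succ_of_half_lt 1 hδ (by push_cast; linarith)

/-- **The barrier's mechanism has no instance in `d = 2`**: the hypothesis shape of the tree's
`EguchiKawaiBreakdown_of_smallBall` (`∃ δ > 0, e > d/4, C` with `EKSymSmallBallBound d δ e C`) is unsatisfiable at `d = 2`. -/
theorem not_exists_margin_two :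
    ¬ ∃ δ e C : ℝ, 0 < δ ∧ ((2 : ℕ) : ℝ) / 4 < e ∧ EKSymSmallBallBound 2 δ e C := by
  rintro ⟨δ, e, C, hδ, he, h⟩
  exact not_ekSymSmallBallBound_two_of_half_lt hδ (by push_cast at he; linarith) h

/-- **The same for `d = 1`** (one link: `S_R ≡ 0`, no exponent above `0 = (d−1)/2` — in particular none above `d/4`). -/
theorem not_exists_margin_one :
    ¬ ∃ δ e C : ℝ, 0 < δ ∧ ((1 : ℕ) : ℝ) / 4 < e ∧ EKSymSmallBallBound 1 δ e C := by
  rintro ⟨δ, e, C, hδ, he, h⟩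
  exact not_ekSymSmallBallBound_succ_of_half_lt 0 hδ (by push_cast at he ⊢; linarith) h

/-- **The exponent window of the mechanism, `d/4 < e ≤ (d − 1)/2`, is non-empty exactly for `d ≥ 3`** — the dimension
threshold of `EguchiKawaiBreakdown`. -/
theorem margin_window_nonempty_iff (d : ℕ) : (d : ℝ) / 4 < ((d : ℝ) - 1) / 2 ↔ 3 ≤ d := by
  constructor
  · intro h
    by_contra hlt
    push Not at hlt
    interval_cases d <;> norm_num at h
  · intro h
    have : (3 : ℝ) ≤ d := by exact_mod_cast h
    linarith

/-- `d = 0` (no links): the region is everything, so no bound with `e > 0` holds. -/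
theorem not_ekSymSmallBallBound_zero {δ e C : ℝ} (he : 0 < e) : ¬ EKSymSmallBallBound 0 δ e C := by
  rintro ⟨N₀, hN⟩
  have htpos : 0 < Real.exp (-(|C| + 1) / e) := Real.exp_pos _
  have hb := hN (N₀ + 1) (Nat.le_succ _) _ htpos
  have hfull : ekSymRegion 0 (N₀ + 1) δ ∩ {U | ekAction U ≤ Real.exp (-(|C| + 1) / e)} = Set.univ := by
    ext U
    simp only [Set.mem_inter_iff, Set.mem_setOf_eq, Set.mem_univ, iff_true]
    refine ⟨fun μ => Fin.elim0 μ, ?_⟩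
    show ekAction U ≤ _
    simp only [ekAction, Finset.univ_eq_empty, Finset.sum_empty]
    exact htpos.le
  have h1 : ekHaar 0 (N₀ + 1) Set.univ = 1 := by unfold ekHaar; exact measure_univ
  rw [hfull, h1, ← ENNReal.ofReal_one, ENNReal.ofReal_le_ofReal_iff (Real.exp_pos _).le] at hb
  have hb' := Real.log_le_log one_pos hb
  rw [Real.log_one, Real.log_exp, Real.log_exp] at hb'
  have hneg : e * (-(|C| + 1) / e) + C < 0 := by
    rw [show e * (-(|C| + 1) / e) = -(|C| + 1) by field_simp]
    have := le_abs_self C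
    linarith
  have hN2 : (0 : ℝ) < ((N₀ + 1 : ℕ) : ℝ) ^ 2 := by positivity
  nlinarith

/-- **Below the threshold the mechanism is void**: for `d ≤ 2` there are no `δ > 0`, `e > d/4`, `C` with
`EKSymSmallBallBound d δ e C`. -/
theorem not_exists_margin_of_le_two {d : ℕ} (hd : d ≤ 2) :
    ¬ ∃ δ e C : ℝ, 0 < δ ∧ (d : ℝ) / 4 < e ∧ EKSymSmallBallBound d δ e C := by
  rintro ⟨δ, e, C, hδ, he, h⟩
  interval_cases d
  · exact not_ekSymSmallBallBound_zero (by push_cast at he; linarith) h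
  · exact not_exists_margin_one ⟨δ, e, C, hδ, he, h⟩
  · exact not_exists_margin_two ⟨δ, e, C, hδ, he, h⟩

end Summit.QuantumFields.YangMills.Theorems.EguchiKawaiDirectionLadder

end
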